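import Literature.InformationTheory.QuantumCodes.MinWeightDecodingClusters
import Mathlib.Algebra.BigOperators.Group.Finset.Basic
import Mathlib.Data.Fintype.Pi
import HarnessLib

/-!
# Irreducible undetectable operators of a CSS code (one error type): decomposition and the
# Dumer–Kovalev–Pryadko count `N_m ≤ n (w-1)^{m-1}`

Topic `Literature/InformationTheory/QuantumCodes` (venture QEC, LADDER-QEC rung Q5; qec-lit-2). This file
PROVES, for one error type of a CSS code (so that a `Z`-type Pauli operator modulo phases IS its support, a
subset `U` of the qubits `V`, and it is undetectable iff every `X`-check meets `U` an even number of times,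
i.e. `H 𝟙_U = 0` for the binary check matrix `H`), the two combinatorial inputs of the threshold bounds of
Dumer, Kovalev and Pryadko, *Thresholds for correcting errors, erasures, and faulty syndrome measurements in
degenerate quantum codes*, PRL 115 (2015) 050502 [DumerKovalevPryadko2015]:

* **Definition 1** ("an undetectable operator is called irreducible if it cannot be decomposed as a product
  of two undetectable Pauli operators with support on non-empty disjoint sets of qubits") — `IsIrreducible H U`:
  `U ≠ ∅`, `H 𝟙_U = 0`, and no non-empty proper subset of `U` is undetectable (for one error type the two
  formulations coincide: a proper undetectable part `T` splits `U = T ⊔ (U ∖ T)` into two undetectable parts,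
  `IsUndetectable.sdiff`);
* **Lemma 4** ("Any undetectable operator … can be written as [a product of] irreducible and pairwise disjoint"
  undetectable operators) in the form the threshold proofs consume: an undetectable operator that is NOT in the
  trivial subspace `SX` (not a stabilizer) contains an irreducible undetectable operator that is not in `SX`
  (`exists_irreducible_subset`; `SX` any subspace of `𝔽₂^V`, e.g. the row space of `H_Z`), hence has weight
  `≥ d` (`IsIrreducible.le_card`, with the distance entering as the hypothesis `∀ x ∈ ker H ∖ SX, d ≤ ‖x‖`);
* the **cluster-enumeration bound**, eq. (upper-bound-Nm-CSS): if every row of `H` has weight `≤ w`, the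
  number `N_m` of irreducible undetectable sets of size `m` is at most `|V| · (w-1)^{m-1}`
  (`card_irreducible_le`). Printed argument (p. 3): "Start by placing [an error] at a position `j` … At every
  subsequent step, take the generator `G_i` corresponding to a non-zero syndrome bit …, and choose any position
  `j` in the support of `G_i` that is not yet selected; there are up to `wgt G_i - 1` choices … all irreducible
  operators of weight `m` are constructed with depth-`m` recursion … The procedure cannot end earlier since `U`
  is irreducible". Formalised as the growth map `grow` / `build` (start site `v`, a list of choice indices
  `< w - 1`) and the surjectivity statement `exists_build_eq`: every irreducible `U ∋ v` is `build H v js` for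
  some admissible `js` of length `|U| - 1`, so the irreducible `m`-sets inject into `V × [w-1]^{m-1}`.

These feed (i) the ERASURE threshold `y < 1/(w-1)` (ibid. p. 4: "in the case of erasures … a bad error must
cover the entire support of `U`, which gives simply `y^{wgt U}` … `Σ_{m ≥ d} N_m y^m → 0`"; the toric-code value
`y_c ≥ 1/3`, p. 5) and (ii) the improved code-capacity threshold `2(w-1)√(p(1-p)) < 1` for minimum-weight
decoding (Thm. 2 with `y = 0`), both in separate files. No probability here: pure `𝔽₂`-combinatorics.

Vocabulary reused: `supp` (`MinWeightDecodingClusters.lean`), Mathlib `hammingNorm`, `Matrix.mulVec`. The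
indicator vector of a set is `vecOf` (generic vertex type `V`; the tree's `errorVec` is its `Fin n` instance and
`ToricCode.chainOf` its toric instance — both definitionally the same formula).

## References

* [DumerKovalevPryadko2015] I. Dumer, A. A. Kovalev, L. P. Pryadko, PRL 115 (2015) 050502, arXiv:1412.6172
  (held `paper:arxiv-1412.6172`): Def. 1 and Lemma 4 (chunk p0003 L142 – p0004 L14), eq. (min-E-condition)
  /(succesful-decoding) (p0004 L40–66), cluster enumeration and eq. (upper-bound-Nm) (p0004 L80–L140),
  eq. (upper-bound-Nm-CSS) `N_m^{(X)} ≤ n (w_Z-1)^{m-1}` (p0005 L26–33).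
* [DumerKovalevPryadko2017] I. Dumer, A. A. Kovalev, L. P. Pryadko, IEEE Trans. IT 63 (2017), §5 Def. 1
  (irreducible codewords) — the classical-code form, cf. `LinkedCluster.lean`.
-/

namespace Literature.InformationTheory.QuantumCodes

open Finset Matrix

variable {ι V : Type*} [Fintype V] [DecidableEq V]

/-! ### One-type Pauli operators as subsets: indicator vectors -/

/-- The indicator vector `𝟙_U ∈ 𝔽₂^V` of a set of qubits `U` — a `Z`-type (or `X`-type) Pauli operator
modulo phases is determined by its support. [cite: DumerKovalevPryadko2015, p. 3 (operators composed only of Z)] -/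
def vecOf (U : Finset V) : V → ZMod 2 := fun v => if v ∈ U then 1 else 0

omit [Fintype V] in
/-- Value of the indicator inside the set (the operator acts on `v`). [cite: DumerKovalevPryadko2015, p. 3 (support of a Pauli operator)] -/
@[simp] theorem vecOf_apply_of_mem {U : Finset V} {v : V} (h : v ∈ U) : vecOf U v = 1 := by
  simp [vecOf, h]

omit [Fintype V] in
/-- Value of the indicator outside the set (the operator is the identity at `v`). [cite: DumerKovalevPryadko2015, p. 3 (support of a Pauli operator)] -/
@[simp] theorem vecOf_apply_of_not_mem {U : Finset V} {v : V} (h : v ∉ U) : vecOf U v = 0 := by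
  simp [vecOf, h]

/-- A non-zero element of `𝔽₂` is `1`. [folklore] -/
private theorem zmod2_eq_one_of_ne_zero {a : ZMod 2} (h : a ≠ 0) : a = 1 := by
  revert a; decide

/-- `supp 𝟙_U = U`: the support of the operator with support `U`. [cite: DumerKovalevPryadko2015, p. 3 (support of a Pauli operator)] -/
theorem supp_vecOf (U : Finset V) : supp (vecOf U) = U := by
  ext v
  simp only [supp, vecOf, mem_filter, mem_univ, true_and]
  by_cases h : v ∈ U <;> simp [h]

/-- `𝟙_{supp x} = x`: a one-type operator modulo phases is determined by its support. [cite: DumerKovalevPryadko2015, p. 3 (operators composed only of Z)] -/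
theorem vecOf_supp (x : V → ZMod 2) : vecOf (supp x) = x := by
  funext v
  by_cases h : x v = 0
  · have hv : v ∉ supp x := by simp [supp, h]
    rw [vecOf_apply_of_not_mem hv, h]
  · have hv : v ∈ supp x := by simp [supp, h]
    rw [vecOf_apply_of_mem hv, zmod2_eq_one_of_ne_zero h]

/-- The weight of `𝟙_U` is `|U|` ("`m ≡ wgt U`"). [cite: DumerKovalevPryadko2015, p. 4 (m ≡ wgt U)] -/
theorem hammingNorm_vecOf (U : Finset V) : hammingNorm (vecOf U) = U.card := by
  have h : (supp (vecOf U)).card = hammingNorm (vecOf U) := rfl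
  rw [← h, supp_vecOf]

omit [Fintype V] in
/-- The indicator of the empty set is `0` (the identity operator). [folklore] -/
private theorem vecOf_empty : vecOf (∅ : Finset V) = 0 := by
  funext v
  simp [vecOf]

omit [Fintype V] in
/-- Splitting a set: `𝟙_U = 𝟙_T + 𝟙_{U ∖ T}` for `T ⊆ U` (disjoint supports add in `𝔽₂`).
[cite: DumerKovalevPryadko2015, Def 1 (product of operators with disjoint supports)] -/
theorem vecOf_eq_add_of_subset {T U : Finset V} (h : T ⊆ U) : vecOf U = vecOf T + vecOf (U \ T) := by
  funext v
  simp only [Pi.add_apply]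
  by_cases hT : v ∈ T
  · have hU : v ∈ U := h hT
    have hUT : v ∉ U \ T := fun h' => (mem_sdiff.1 h').2 hT
    rw [vecOf_apply_of_mem hU, vecOf_apply_of_mem hT, vecOf_apply_of_not_mem hUT, add_zero]
  · by_cases hU : v ∈ U
    · have hUT : v ∈ U \ T := mem_sdiff.2 ⟨hU, hT⟩
      rw [vecOf_apply_of_mem hU, vecOf_apply_of_not_mem hT, vecOf_apply_of_mem hUT, zero_add]
    · have hUT : v ∉ U \ T := fun h' => hU (mem_sdiff.1 h').1
      rw [vecOf_apply_of_not_mem hU, vecOf_apply_of_not_mem hT, vecOf_apply_of_not_mem hUT, add_zero]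

/-- The syndrome bit of check `i` on the operator `𝟙_U` is `Σ_{v ∈ U} H i v` (the parity of the number of
positions of `U` met by the check). [cite: DumerKovalevPryadko2015, p. 3 (syndrome bits of a cluster)] -/
theorem mulVec_vecOf_apply (H : Matrix ι V (ZMod 2)) (U : Finset V) (i : ι) :
    (H *ᵥ vecOf U) i = ∑ v ∈ U, H i v := by
  simp only [Matrix.mulVec, dotProduct, vecOf, mul_ite, mul_one, mul_zero]
  rw [Finset.sum_ite_mem, Finset.univ_inter]

/-! ### Undetectable and irreducible sets -/

/-- `U` is **undetectable** (for the checks `H`): `H 𝟙_U = 0`, i.e. every check meets `U` an even number of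
times — the one-type form of "undetectable operator" (zero syndrome).
[cite: DumerKovalevPryadko2015, Def 1 (undetectable operator)] -/
def IsUndetectable (H : Matrix ι V (ZMod 2)) (U : Finset V) : Prop :=
  H *ᵥ vecOf U = 0

/-- For a binary vector `x`: `supp x` is undetectable iff `H x = 0` (zero syndrome). [cite: DumerKovalevPryadko2015, Def 1 (undetectable operator)] -/
theorem isUndetectable_supp_iff (H : Matrix ι V (ZMod 2)) (x : V → ZMod 2) :
    IsUndetectable H (supp x) ↔ H *ᵥ x = 0 := by
  rw [IsUndetectable, vecOf_supp]

/-- If `U` and its part `T ⊆ U` are undetectable, so is the complementary part `U ∖ T` (the syndrome is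
additive over disjoint supports). [cite: DumerKovalevPryadko2015, Lemma 4 (proof)] -/
theorem IsUndetectable.sdiff {H : Matrix ι V (ZMod 2)} {T U : Finset V} (hU : IsUndetectable H U)
    (hT : IsUndetectable H T) (h : T ⊆ U) : IsUndetectable H (U \ T) := by
  unfold IsUndetectable at hU hT ⊢
  rw [vecOf_eq_add_of_subset h, Matrix.mulVec_add, hT, zero_add] at hU
  exact hU

/-- **Irreducible undetectable operator** (one error type): a non-empty undetectable set of qubits no
non-empty proper subset of which is undetectable — "an undetectable operator is called irreducible if it
cannot be decomposed as a product of two undetectable Pauli operators with support on non-empty disjoint sets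
of qubits". [cite: DumerKovalevPryadko2015, Def 1] -/
structure IsIrreducible (H : Matrix ι V (ZMod 2)) (U : Finset V) : Prop where
  /-- an irreducible operator is not the identity -/
  nonempty : U.Nonempty
  /-- it is undetectable -/
  undetectable : IsUndetectable H U
  /-- and no non-empty proper part of it is undetectable -/
  not_undetectable_of_ssubset : ∀ T : Finset V, T ⊂ U → T.Nonempty → ¬ IsUndetectable H T

/-- **Decomposition (DKP15 Lemma 4, in the form used by the threshold proofs).** An undetectable operator
that is not in the trivial subspace `SX` contains an IRREDUCIBLE undetectable operator that is not in `SX`: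
split off undetectable proper parts ("`E = ∏ J_i` … irreducible and pairwise disjoint"); since `SX` is a
subspace one of the parts stays outside `SX`; induct on the support.
[cite: DumerKovalevPryadko2015, Lemma 4] -/
theorem exists_irreducible_subset (H : Matrix ι V (ZMod 2)) (SX : Submodule (ZMod 2) (V → ZMod 2))
    (U : Finset V) (hU : IsUndetectable H U) (hS : vecOf U ∉ SX) :
    ∃ W : Finset V, W ⊆ U ∧ IsIrreducible H W ∧ vecOf W ∉ SX := by
  classical
  induction hn : U.card using Nat.strong_induction_on generalizing U with
  | _ k ih =>
  by_cases hirr : ∀ T : Finset V, T ⊂ U → T.Nonempty → ¬ IsUndetectable H T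
  · have hne : U.Nonempty := by
      rw [nonempty_iff_ne_empty]
      rintro rfl
      rw [vecOf_empty] at hS
      exact hS SX.zero_mem
    exact ⟨U, Subset.rfl, ⟨hne, hU, hirr⟩, hS⟩
  · push Not at hirr
    obtain ⟨T, hTU, hTne, hT⟩ := hirr
    have hsplit := vecOf_eq_add_of_subset hTU.subset
    have hUT : IsUndetectable H (U \ T) := hU.sdiff hT hTU.subset
    have hor : vecOf T ∉ SX ∨ vecOf (U \ T) ∉ SX := by
      by_contra h
      push Not at h
      apply hS
      rw [hsplit]
      exact SX.add_mem h.1 h.2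
    rcases hor with h1 | h2
    · have hcard : T.card < k := hn ▸ card_lt_card hTU
      obtain ⟨W, hWT, hW, hWS⟩ := ih _ hcard T hT h1 rfl
      exact ⟨W, hWT.trans hTU.subset, hW, hWS⟩
    · have hcard : (U \ T).card < k := by
        rw [← hn, card_sdiff_of_subset hTU.subset]
        have h1 := hTne.card_pos
        have h2 := card_le_card hTU.subset
        omega
      obtain ⟨W, hWT, hW, hWS⟩ := ih _ hcard (U \ T) hUT h2 rfl
      exact ⟨W, hWT.trans sdiff_subset, hW, hWS⟩

/-- Vector form of the decomposition: a zero-syndrome vector outside `SX` (a non-trivial logical operator of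
this error type) has an irreducible undetectable subset of its support whose indicator is outside `SX`.
[cite: DumerKovalevPryadko2015, Lemma 4] -/
theorem exists_irreducible_of_mulVec_eq_zero (H : Matrix ι V (ZMod 2))
    (SX : Submodule (ZMod 2) (V → ZMod 2)) {x : V → ZMod 2} (hx : H *ᵥ x = 0) (hxS : x ∉ SX) :
    ∃ W : Finset V, W ⊆ supp x ∧ IsIrreducible H W ∧ vecOf W ∉ SX :=
  exists_irreducible_subset H SX (supp x) ((isUndetectable_supp_iff H x).2 hx) (by rwa [vecOf_supp])

/-- An irreducible undetectable operator outside `SX` is a non-trivial logical operator, so it has at least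
`d` qubits when `d` lower-bounds the weight of every zero-syndrome vector outside `SX` ("`N_m = 0` for
`m < d`"). [cite: DumerKovalevPryadko2015, p. 4 (N_m = 0 for m < d)] -/
theorem IsIrreducible.le_card {H : Matrix ι V (ZMod 2)} {SX : Submodule (ZMod 2) (V → ZMod 2)} {d : ℕ}
    (hd : ∀ x : V → ZMod 2, H *ᵥ x = 0 → x ∉ SX → d ≤ hammingNorm x) {W : Finset V}
    (hW : IsIrreducible H W) (hWS : vecOf W ∉ SX) : d ≤ W.card := by
  have h := hd (vecOf W) hW.undetectable hWS
  rwa [hammingNorm_vecOf] at h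

/-! ### The cluster enumeration -/

/-- The support of check (row) `i` of `H`: the qubits it acts on. [cite: DumerKovalevPryadko2015, p. 3 (support of G_i)] -/
def rowSupp (H : Matrix ι V (ZMod 2)) (i : ι) : Finset V :=
  univ.filter fun v => H i v ≠ 0

/-- A violated check meets the current selection: if the syndrome bit `i` of `𝟙_T` is non-zero then
`supp G_i ∩ T ≠ ∅`. [cite: DumerKovalevPryadko2015, p. 3 (non-zero syndrome bit)] -/
theorem rowSupp_inter_nonempty_of_apply_ne_zero {H : Matrix ι V (ZMod 2)} {T : Finset V} {i : ι}
    (hi : (H *ᵥ vecOf T) i ≠ 0) : (rowSupp H i ∩ T).Nonempty := by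
  rw [mulVec_vecOf_apply] at hi
  obtain ⟨v, hv, hHv⟩ := Finset.exists_ne_zero_of_sum_ne_zero hi
  exact ⟨v, mem_inter.2 ⟨mem_filter.2 ⟨mem_univ _, hHv⟩, hv⟩⟩

/-- "there are up to `wgt G_i - 1` choices": if row `i` has weight `≤ w` and meets `T`, at most `w - 1` of its
positions lie outside `T`. [cite: DumerKovalevPryadko2015, p. 3 (up to wgt G_i − 1 choices)] -/
theorem card_rowSupp_sdiff_le {H : Matrix ι V (ZMod 2)} {T : Finset V} {i : ι} {w : ℕ}
    (hrow : (rowSupp H i).card ≤ w) (hne : (rowSupp H i ∩ T).Nonempty) :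
    (rowSupp H i \ T).card ≤ w - 1 := by
  have h1 : (rowSupp H i \ T).card + (rowSupp H i ∩ T).card = (rowSupp H i).card :=
    Finset.card_sdiff_add_card_inter _ _
  have h2 := hne.card_pos
  omega

/-- The steering step: if `T ⊆ U` with `U` undetectable and check `i` violated by `𝟙_T`, then check `i` meets
`U` outside `T` (its parity on `U` is even, on `T` odd). [cite: DumerKovalevPryadko2015, p. 3 ("keep choosing only such terms at every step")] -/
theorem exists_mem_sdiff_of_apply_ne_zero {H : Matrix ι V (ZMod 2)} {T U : Finset V} (hTU : T ⊆ U)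
    (hU : IsUndetectable H U) {i : ι} (hi : (H *ᵥ vecOf T) i ≠ 0) : ∃ u ∈ U \ T, H i u ≠ 0 := by
  have h0 : (H *ᵥ vecOf U) i = 0 := by
    rw [hU]
    rfl
  rw [vecOf_eq_add_of_subset hTU, Matrix.mulVec_add, Pi.add_apply] at h0
  have hne : (H *ᵥ vecOf (U \ T)) i ≠ 0 := by
    intro h
    rw [h, add_zero] at h0
    exact hi h0
  rw [mulVec_vecOf_apply] at hne
  exact Finset.exists_ne_zero_of_sum_ne_zero hne

open Classical in
/-- **One step of the cluster enumeration.** If some check is violated by the current selection `T`, take a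
violated check `G_i` (a fixed choice) and add to `T` the `j`-th position of `supp G_i ∖ T` (in a fixed
enumeration); otherwise (zero syndrome: "a completed undetectable cluster"), or if `j` is out of range, stay.
[cite: DumerKovalevPryadko2015, p. 3 (cluster-enumeration algorithm)] -/
noncomputable def grow (H : Matrix ι V (ZMod 2)) (T : Finset V) (j : ℕ) : Finset V :=
  if h : ∃ i, (H *ᵥ vecOf T) i ≠ 0 then
    match ((rowSupp H (Classical.choose h)) \ T).toList[j]? with
    | some v => insert v T
    | none => T
  else T

/-- **The cluster enumeration**: start from the single position `v` ("Start by placing [an error] at a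
position `j`") and apply the growth steps coded by the list of choice indices `js`.
[cite: DumerKovalevPryadko2015, p. 3 (cluster-enumeration algorithm)] -/
noncomputable def build (H : Matrix ι V (ZMod 2)) (v : V) (js : List ℕ) : Finset V :=
  js.foldl (grow H) {v}

/-- Depth `0` of the enumeration: the start position alone. [cite: DumerKovalevPryadko2015, p. 3] -/
theorem build_nil (H : Matrix ι V (ZMod 2)) (v : V) : build H v [] = {v} := rfl

/-- One more step of the enumeration. [cite: DumerKovalevPryadko2015, p. 3] -/
theorem build_append_singleton (H : Matrix ι V (ZMod 2)) (v : V) (js : List ℕ) (j : ℕ) :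
    build H v (js ++ [j]) = grow H (build H v js) j := by
  simp [build, List.foldl_append]

/-- **The enumeration can be steered towards any irreducible operator**: if `T` is a non-empty proper part
of the irreducible `U` (so some check is violated by `T`) then one admissible growth step — a choice index
`j < w - 1` — adds a position of `U` to `T`. [cite: DumerKovalevPryadko2015, p. 3 ("all irreducible operators of weight m are constructed with depth-m recursion")] -/
theorem exists_grow_subset {H : Matrix ι V (ZMod 2)} {w : ℕ} (hrow : ∀ i, (rowSupp H i).card ≤ w)
    {T U : Finset V} (hU : IsIrreducible H U) (hTU : T ⊂ U) (hTne : T.Nonempty) :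
    ∃ j, j < w - 1 ∧ grow H T j ⊆ U ∧ (grow H T j).card = T.card + 1 := by
  classical
  have hdet : ∃ i, (H *ᵥ vecOf T) i ≠ 0 := by
    have h := hU.not_undetectable_of_ssubset T hTU hTne
    unfold IsUndetectable at h
    by_contra hall
    push Not at hall
    exact h (funext fun i => hall i)
  have hi₀ : (H *ᵥ vecOf T) (Classical.choose hdet) ≠ 0 := Classical.choose_spec hdet
  obtain ⟨u, hu, hHu⟩ := exists_mem_sdiff_of_apply_ne_zero hTU.subset hU.undetectable hi₀
  have huT : u ∉ T := (mem_sdiff.1 hu).2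
  have huA : u ∈ rowSupp H (Classical.choose hdet) \ T :=
    mem_sdiff.2 ⟨mem_filter.2 ⟨mem_univ _, hHu⟩, huT⟩
  have hAcard : (rowSupp H (Classical.choose hdet) \ T).card ≤ w - 1 :=
    card_rowSupp_sdiff_le (hrow _) (rowSupp_inter_nonempty_of_apply_ne_zero hi₀)
  obtain ⟨j, hj, hju⟩ := List.getElem_of_mem (Finset.mem_toList.2 huA)
  refine ⟨j, ?_, ?_⟩
  · rw [Finset.length_toList] at hj
    omega
  · have hgrow : grow H T j = insert u T := by
      unfold grow
      rw [dif_pos hdet]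
      have hsome : (rowSupp H (Classical.choose hdet) \ T).toList[j]? = some u := by
        rw [List.getElem?_eq_getElem hj, hju]
      simp only [hsome]
    rw [hgrow, card_insert_of_notMem huT]
    exact ⟨insert_subset (mem_sdiff.1 hu).1 hTU.subset, rfl⟩

/-- The steered enumeration reaches every prefix size: for an irreducible `U ∋ v` and every `k < |U|` some
admissible choice list of length `k` builds a `(k+1)`-subset of `U`.
[cite: DumerKovalevPryadko2015, p. 3 ("the recursion will result in the list corresponding to U after exactly m steps")] -/
theorem exists_build_subset {H : Matrix ι V (ZMod 2)} {w : ℕ} (hrow : ∀ i, (rowSupp H i).card ≤ w)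
    {U : Finset V} (hU : IsIrreducible H U) {v : V} (hv : v ∈ U) :
    ∀ k, k < U.card → ∃ js : List ℕ, js.length = k ∧ (∀ j ∈ js, j < w - 1) ∧
      build H v js ⊆ U ∧ (build H v js).card = k + 1 := by
  intro k
  induction k with
  | zero =>
    intro _
    refine ⟨[], rfl, by simp, ?_, ?_⟩
    · rw [build_nil]
      exact singleton_subset_iff.2 hv
    · rw [build_nil, card_singleton]
  | succ k ih =>
    intro hk
    obtain ⟨js, hlen, hjs, hsub, hcard⟩ := ih (by omega)
    have hne : build H v js ≠ U := by
      intro h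
      rw [h] at hcard
      omega
    have hss : build H v js ⊂ U := Finset.ssubset_iff_subset_ne.2 ⟨hsub, hne⟩
    have hne' : (build H v js).Nonempty := by
      rw [← card_pos, hcard]
      omega
    obtain ⟨j, hj, hsub', hcard'⟩ := exists_grow_subset hrow hU hss hne'
    refine ⟨js ++ [j], by simp [hlen], ?_, ?_, ?_⟩
    · intro x hx
      rw [List.mem_append, List.mem_singleton] at hx
      rcases hx with hx | rfl
      · exact hjs x hx
      · exact hj
    · rwa [build_append_singleton]
    · rw [build_append_singleton, hcard', hcard]

/-- **Surjectivity of the enumeration onto the irreducible operators**: every irreducible `U` containing `v`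
is `build H v js` for an admissible list `js` (entries `< w - 1`) of length `|U| - 1`.
[cite: DumerKovalevPryadko2015, p. 3 ("all irreducible operators of weight m are constructed with depth-m recursion")] -/
theorem exists_build_eq {H : Matrix ι V (ZMod 2)} {w : ℕ} (hrow : ∀ i, (rowSupp H i).card ≤ w)
    {U : Finset V} (hU : IsIrreducible H U) {v : V} (hv : v ∈ U) :
    ∃ js : List ℕ, js.length = U.card - 1 ∧ (∀ j ∈ js, j < w - 1) ∧ build H v js = U := by
  have hpos := hU.nonempty.card_pos
  obtain ⟨js, hlen, hjs, hsub, hcard⟩ := exists_build_subset hrow hU hv (U.card - 1) (by omega)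
  exact ⟨js, hlen, hjs, eq_of_subset_of_card_le hsub (by omega)⟩

/-- **The Dumer–Kovalev–Pryadko count of irreducible operators**, eq. (upper-bound-Nm-CSS): if every
check has weight `≤ w`, the number `N_m` of irreducible undetectable sets of size `m` (one error type of a
CSS code on the qubit set `V`) satisfies `N_m ≤ |V| · (w-1)^{m-1}` ("`3n` possible choices for the first step,
and up to `2(wgt G_i - 1)` for each subsequent step"; for one fixed error type the factors `3` and `2`
disappear: `N_m^{(X)} ≤ n (w_Z - 1)^{m-1}`). [cite: DumerKovalevPryadko2015, eq. (upper-bound-Nm-CSS)] -/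
theorem card_irreducible_le (H : Matrix ι V (ZMod 2)) {w : ℕ} (hrow : ∀ i, (rowSupp H i).card ≤ w)
    (m : ℕ) [DecidablePred (IsIrreducible H)] :
    (univ.filter fun U : Finset V => IsIrreducible H U ∧ U.card = m).card ≤
      Fintype.card V * (w - 1) ^ (m - 1) := by
  classical
  rcases Nat.eq_zero_or_pos m with rfl | hm
  · have h0 : (univ.filter fun U : Finset V => IsIrreducible H U ∧ U.card = 0) = ∅ := by
      rw [Finset.filter_eq_empty_iff]
      rintro U - ⟨hU, hc⟩
      exact hU.nonempty.ne_empty (card_eq_zero.1 hc)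
    rw [h0, card_empty]
    exact Nat.zero_le _
  · set F : V × (Fin (m - 1) → Fin (w - 1)) → Finset V :=
      fun vf => build H vf.1 (List.ofFn fun k => ((vf.2 k : Fin (w - 1)) : ℕ)) with hF
    have hsub : (univ.filter fun U : Finset V => IsIrreducible H U ∧ U.card = m) ⊆ univ.image F := by
      intro U hU
      rw [mem_filter] at hU
      obtain ⟨-, hirr, hm'⟩ := hU
      obtain ⟨v, hv⟩ := hirr.nonempty
      obtain ⟨js, hlen, hjs, hbuild⟩ := exists_build_eq hrow hirr hv
      rw [hm'] at hlen
      rw [mem_image]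
      refine ⟨(v, fun k => ⟨js[k.val]'(by rw [hlen]; exact k.isLt), hjs _ (List.getElem_mem _)⟩),
        mem_univ _, ?_⟩
      rw [← hbuild]
      simp only [hF]
      congr 1
      apply List.ext_getElem
      · simp [hlen]
      · intro k h1 h2
        simp
    calc (univ.filter fun U : Finset V => IsIrreducible H U ∧ U.card = m).card
        ≤ (univ.image F).card := card_le_card hsub
      _ ≤ (univ : Finset (V × (Fin (m - 1) → Fin (w - 1)))).card := card_image_le
      _ = Fintype.card V * (w - 1) ^ (m - 1) := by
          rw [card_univ, Fintype.card_prod, Fintype.card_fun, Fintype.card_fin, Fintype.card_fin]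

end Literature.InformationTheory.QuantumCodes
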